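import Summits.QuantumFields.YangMills.Theorems.AllWindowsColdBoxBoxHighLineQuarticVertexForm
import Summits.QuantumFields.YangMills.Theorems.AllWindowsColdBoxBoxHighLineWickPairCubicForm
import Summits.QuantumFields.YangMills.Theorems.AllWindowsColdBoxBoxHighLineQuarticVertexGroups

/-!
# `ConnectedThreePoint`, QUARTIC vertices: the rank-one collapse — «X» diagrams `D⁰·D^T` (four gradient lines) and «tadpoles» `K(0,T)`·gradient·gradient·self-line
# (U5-BLOCKERS §2, lift L2 / ASSEMBLY-U5 §3)

Width seat `ym-line-sfw-p2-w3` (g41), cell ym-idea-1; U5 prep, helper-grade.  Third file of the quartic-vertex part (✓`…QuarticVertexWick` monomial, ✓`…QuarticVertexForm` two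
forms).  For the colour-diagonal RANK-ONE forms `L⁰ = [κ=κ']·w₀⊗w₀`, `L^T = [κ=κ']·w₁⊗w₁` (`w = landauCoeff`, ✓`Cum3Triangle.linCurvSq_eq_quadVal`) and the colour-diagonal
propagator `S = (2β)⁻¹·(g⊗1)`, summing the 72 connected pairings against `L⁰_{aa'}L^T_{bb'}` collapses them (✓`ColourDiag.sum_rankOne_mul_mul` + the two-kernel version
`ColourDiag.sum_rankOne_mul_mul₂` here) to

  `E₀[Q_AQ_BN] − E₀[Q_AQ_B]E₀[N] = 4·Σ_{6 splits} D⁰(n_i,n_j)·D^T(n_k,n_l) + 4·Σ_{12 ordered (i,j)} T(n_i,n_j)·S(n_k,n_l)`,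
  `D⁰(i,j) = (2β)⁻¹^2·[κ_i=κ_j]·(w₀ ᵥ* g)_i (w₀ ᵥ* g)_j` (two gradient lines from `p₀`), `D^T` likewise,
  `T(i,j) = (2β)⁻¹^3·[κ_i=κ_j]·((w₀ ᵥ* g) ⬝ᵥ w₁)·(w₀ ᵥ* g)_i·(w₁ ᵥ* g)_j` (the dipole-type chain `Λ₀·g·Λ_T = K(0,T)` × one gradient line from each plaquette)

(★★ `gauss_centredRankOne_centredRankOne_mul_four_connected`).  Cold-box sizes (next file / assembler): «X» `≲ β⁻⁴(1+log H)⁴(1+d(x,p₀))⁻⁶(1+d(x,p_T))⁻⁶`, «tadpole»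
`≲ β⁻⁴(1+log H)⁴(1+T)⁻⁴(1+d(x,p₀))⁻³(1+d(x,p_T))⁻³·S(n,n)` — after the vertex sum RELATIVE `≲ H⁴·polylog/β` to the main term, replacing blocker B2's `H¹²/β` for the
quartic vertices `W₄`, `Φ⁴`.

Tree + Mathlib only; no definitions; standard axioms.  HONEST LABEL: a tool for the RECORDED lift L2 of the NEXT rung U5 (⟨stmt-QuantumFields-24336⟩, UNSTAFFED);
⟨24004⟩ ⟨24336⟩ remain OPEN; route AllWindowsColdBox is DRAFT; no crux, rung or summit is proved; **the Yang–Mills mass gap is NOT proved by this file; no summit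
is proved by a line.**
-/

set_option autoImplicit false

noncomputable section

open MeasureTheory Matrix Finset

namespace Summit.QuantumFields.YangMills.Theorems.AllWindowsColdBoxBoxHighLine

/-! ## The rank-one collapse of the 72 connected pairings -/

section RankOneQuartic

variable {E : Type*} [Fintype E] [DecidableEq E]

/-- ★★ **Two centred colour-diagonal rank-one forms against a quartic monomial, connected part, collapsed**: «X» diagrams `D⁰·D^T` and «tadpoles»
`T·S`. -/
theorem gauss_centredRankOne_centredRankOne_mul_four_connected (Pm : Matrix (E × Fin 3) (E × Fin 3) ℝ) (hP : Pm.PosDef) {β : ℝ} (hβ : 0 < β)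
    (g : Matrix E E ℝ) (w₀ w₁ : E → ℝ) (S LA LB DA DB TD : (E × Fin 3) → (E × Fin 3) → ℝ) (hSP : ∀ i j, S i j = (2 * β)⁻¹ * Pm⁻¹ i j)
    (hS : ∀ i j, S i j = (2 * β)⁻¹ * if i.2 = j.2 then g i.1 j.1 else 0)
    (hLA : ∀ i j, LA i j = if i.2 = j.2 then w₀ i.1 * w₀ j.1 else 0) (hLB : ∀ i j, LB i j = if i.2 = j.2 then w₁ i.1 * w₁ j.1 else 0)
    (hDA : ∀ i j, DA i j = (2 * β)⁻¹ ^ 2 * if i.2 = j.2 then (w₀ ᵥ* g) i.1 * (w₀ ᵥ* g) j.1 else 0)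
    (hDB : ∀ i j, DB i j = (2 * β)⁻¹ ^ 2 * if i.2 = j.2 then (w₁ ᵥ* g) i.1 * (w₁ ᵥ* g) j.1 else 0)
    (hTD : ∀ i j, TD i j = (2 * β)⁻¹ ^ 3 * if i.2 = j.2 then ((w₀ ᵥ* g) ⬝ᵥ w₁) * ((w₀ ᵥ* g) i.1 * (w₁ ᵥ* g) j.1) else 0)
    (n₀ n₁ n₂ n₃ : E × Fin 3) :
    (∫ v : E × Fin 3 → ℝ, (∑ a, ∑ a', LA a a' * (v a * v a' - S a a')) * (∑ b, ∑ b', LB b b' * (v b * v b' - S b b')) *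
          (v n₀ * v n₁ * v n₂ * v n₃) * Real.exp (-(β * (v ⬝ᵥ Pm *ᵥ v)))) / (∫ v : E × Fin 3 → ℝ, Real.exp (-(β * (v ⬝ᵥ Pm *ᵥ v)))) -
        (∫ v : E × Fin 3 → ℝ, (∑ a, ∑ a', LA a a' * (v a * v a' - S a a')) * (∑ b, ∑ b', LB b b' * (v b * v b' - S b b')) *
            Real.exp (-(β * (v ⬝ᵥ Pm *ᵥ v)))) / (∫ v : E × Fin 3 → ℝ, Real.exp (-(β * (v ⬝ᵥ Pm *ᵥ v)))) *
          ((∫ v : E × Fin 3 → ℝ, v n₀ * v n₁ * v n₂ * v n₃ * Real.exp (-(β * (v ⬝ᵥ Pm *ᵥ v)))) /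
            (∫ v : E × Fin 3 → ℝ, Real.exp (-(β * (v ⬝ᵥ Pm *ᵥ v))))) =
      4 * (DA n₀ n₁ * DB n₂ n₃ + DA n₀ n₂ * DB n₁ n₃ + DA n₀ n₃ * DB n₁ n₂ + DA n₁ n₂ * DB n₀ n₃ + DA n₁ n₃ * DB n₀ n₂ + DA n₂ n₃ * DB n₀ n₁) +
      4 * (TD n₀ n₁ * S n₂ n₃ +
        TD n₀ n₂ * S n₁ n₃ +
        TD n₀ n₃ * S n₁ n₂ +
        TD n₁ n₀ * S n₂ n₃ +
        TD n₁ n₂ * S n₀ n₃ +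
        TD n₁ n₃ * S n₀ n₂ +
        TD n₂ n₀ * S n₁ n₃ +
        TD n₂ n₁ * S n₀ n₃ +
        TD n₂ n₃ * S n₀ n₁ +
        TD n₃ n₀ * S n₁ n₂ +
        TD n₃ n₁ * S n₀ n₂ +
        TD n₃ n₂ * S n₀ n₁) := by
  rw [gauss_centredForm_centredForm_mul_four_connected Pm hP hβ S hSP LA LB n₀ n₁ n₂ n₃]
  set u₀ : E → ℝ := w₀ ᵥ* g with hu₀
  set u₁ : E → ℝ := w₁ ᵥ* g with hu₁
  -- the hypotheses in two-kernel form
  have hS' : ∀ i j, S i j = (2 * β)⁻¹ * if i.2 = j.2 then (fun e e' => g e e') i.1 j.1 else 0 := hS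
  have hDA' : ∀ i j, DA i j = (2 * β)⁻¹ ^ 2 * if i.2 = j.2 then (fun e e' => u₀ e * u₀ e') i.1 j.1 else 0 := hDA
  have hDAs : ∀ i j, DA i j = DA j i := fun i j => by
    rw [hDA, hDA]
    by_cases h : i.2 = j.2
    · rw [if_pos h, if_pos h.symm, mul_comm (u₀ i.1)]
    · rw [if_neg h, if_neg (Ne.symm h)]
  have hDBs : ∀ i j, DB i j = DB j i := fun i j => by
    rw [hDB, hDB]
    by_cases h : i.2 = j.2
    · rw [if_pos h, if_pos h.symm, mul_comm (u₁ i.1)]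
    · rw [if_neg h, if_neg (Ne.symm h)]
  -- «X» diagrams
  have hXc : ∀ P Q R T' : E × Fin 3, (∑ a, ∑ a', ∑ b, ∑ b', LA a a' * LB b b' * ((S a P * S a' Q) * (S b R * S b' T'))) = DA P Q * DB R T' := by
    intro P Q R T'
    have h1 : (∑ a, ∑ a', ∑ b, ∑ b', LA a a' * LB b b' * ((S a P * S a' Q) * (S b R * S b' T'))) =
        (∑ a, ∑ a', LA a a' * (S a P * S a' Q)) * (∑ b, ∑ b', LB b b' * (S b R * S b' T')) := by
      rw [QuadCum3.sum2_mul_sum2]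
      exact QuadCum3.sum4_congr fun _ _ _ _ => by ring
    rw [h1, ColourDiag.sum_rankOne_mul_mul w₀ g _ hLA hS, ColourDiag.sum_rankOne_mul_mul w₁ g _ hLB hS, hDA, hDB]
  -- the inner `a`-collapse of a tadpole, in the two orientations
  have hinA : ∀ (y P : E × Fin 3), (∑ a, ∑ a', LA a a' * (S a y * S a' P)) = DA y P := fun y P => by
    rw [ColourDiag.sum_rankOne_mul_mul w₀ g _ hLA hS, hDA]
  have hinA' : ∀ (y P : E × Fin 3), (∑ a, ∑ a', LA a a' * (S a P * S a' y)) = DA y P := fun y P => by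
    rw [ColourDiag.sum_rankOne_mul_mul w₀ g _ hLA hS, hDAs, hDA]
  -- the outer `b`-collapse, in the two orientations
  have houtB : ∀ P Q : E × Fin 3, (∑ b, ∑ b', LB b b' * (DA b P * S b' Q)) = TD P Q := by
    intro P Q
    rw [ColourDiag.sum_rankOne_mul_mul₂ w₁ (fun e e' => u₀ e * u₀ e') (fun e e' => g e e') _ _ hLB hDA' hS' P Q, hTD]
    by_cases h : P.2 = Q.2
    · rw [if_pos h, if_pos h]
      have e2 : (∑ e, w₁ e * (u₀ e * u₀ P.1)) = (u₀ ⬝ᵥ w₁) * u₀ P.1 := by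
        rw [dotProduct, Finset.sum_mul]; exact Finset.sum_congr rfl fun e _ => by ring
      have e3 : (∑ e, w₁ e * g e Q.1) = u₁ Q.1 := by rw [hu₁, Matrix.vecMul, dotProduct]
      rw [e2, e3]; ring
    · rw [if_neg h, if_neg h]; ring
  have houtB' : ∀ P Q : E × Fin 3, (∑ b, ∑ b', LB b b' * (S b Q * DA b' P)) = TD P Q := by
    intro P Q
    rw [ColourDiag.sum_rankOne_mul_mul₂ w₁ (fun e e' => g e e') (fun e e' => u₀ e * u₀ e') _ _ hLB hS' hDA' Q P, hTD]
    by_cases h : P.2 = Q.2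
    · rw [if_pos h.symm, if_pos h]
      have e2 : (∑ e, w₁ e * (u₀ e * u₀ P.1)) = (u₀ ⬝ᵥ w₁) * u₀ P.1 := by
        rw [dotProduct, Finset.sum_mul]; exact Finset.sum_congr rfl fun e _ => by ring
      have e3 : (∑ e, w₁ e * g e Q.1) = u₁ Q.1 := by rw [hu₁, Matrix.vecMul, dotProduct]
      rw [e2, e3]; ring
    · rw [if_neg (Ne.symm h), if_neg h]; ring
  -- the four tadpole shapes
  have hT1 : ∀ (P Q : E × Fin 3) (c : ℝ),
      (∑ a, ∑ a', ∑ b, ∑ b', LA a a' * LB b b' * (((S a b * S a' P) * S b' Q) * c)) = TD P Q * c := by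
    intro P Q c
    rw [← QuadCum3.sum4_comm22 (fun a a' b b' => LA a a' * LB b b' * (((S a b * S a' P) * S b' Q) * c))]
    have hin : ∀ b b' : E × Fin 3, (∑ a, ∑ a', LA a a' * LB b b' * (((S a b * S a' P) * S b' Q) * c)) =
        c * (LB b b' * (DA b P * S b' Q)) := by
      intro b b'
      rw [← hinA b P]
      simp only [Finset.sum_mul, Finset.mul_sum]
      exact Finset.sum_congr rfl fun a _ => Finset.sum_congr rfl fun a' _ => by ring
    simp only [hin, ← Finset.mul_sum]
    rw [houtB, mul_comm]
  have hT2 : ∀ (P Q : E × Fin 3) (c : ℝ),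
      (∑ a, ∑ a', ∑ b, ∑ b', LA a a' * LB b b' * (((S a b' * S a' P) * S b Q) * c)) = TD P Q * c := by
    intro P Q c
    rw [← QuadCum3.sum4_comm22 (fun a a' b b' => LA a a' * LB b b' * (((S a b' * S a' P) * S b Q) * c))]
    have hin : ∀ b b' : E × Fin 3, (∑ a, ∑ a', LA a a' * LB b b' * (((S a b' * S a' P) * S b Q) * c)) =
        c * (LB b b' * (S b Q * DA b' P)) := by
      intro b b'
      rw [← hinA b' P]
      simp only [Finset.mul_sum]
      exact Finset.sum_congr rfl fun a _ => Finset.sum_congr rfl fun a' _ => by ring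
    simp only [hin, ← Finset.mul_sum]
    rw [houtB', mul_comm]
  have hT3 : ∀ (P Q : E × Fin 3) (c : ℝ),
      (∑ a, ∑ a', ∑ b, ∑ b', LA a a' * LB b b' * (((S a P * S a' b) * S b' Q) * c)) = TD P Q * c := by
    intro P Q c
    rw [← QuadCum3.sum4_comm22 (fun a a' b b' => LA a a' * LB b b' * (((S a P * S a' b) * S b' Q) * c))]
    have hin : ∀ b b' : E × Fin 3, (∑ a, ∑ a', LA a a' * LB b b' * (((S a P * S a' b) * S b' Q) * c)) =
        c * (LB b b' * (DA b P * S b' Q)) := by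
      intro b b'
      rw [← hinA' b P]
      simp only [Finset.sum_mul, Finset.mul_sum]
      exact Finset.sum_congr rfl fun a _ => Finset.sum_congr rfl fun a' _ => by ring
    simp only [hin, ← Finset.mul_sum]
    rw [houtB, mul_comm]
  have hT4 : ∀ (P Q : E × Fin 3) (c : ℝ),
      (∑ a, ∑ a', ∑ b, ∑ b', LA a a' * LB b b' * (((S a P * S a' b') * S b Q) * c)) = TD P Q * c := by
    intro P Q c
    rw [← QuadCum3.sum4_comm22 (fun a a' b b' => LA a a' * LB b b' * (((S a P * S a' b') * S b Q) * c))]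
    have hin : ∀ b b' : E × Fin 3, (∑ a, ∑ a', LA a a' * LB b b' * (((S a P * S a' b') * S b Q) * c)) =
        c * (LB b b' * (S b Q * DA b' P)) := by
      intro b b'
      rw [← hinA' b' P]
      simp only [Finset.mul_sum]
      exact Finset.sum_congr rfl fun a _ => Finset.sum_congr rfl fun a' _ => by ring
    simp only [hin, ← Finset.mul_sum]
    rw [houtB', mul_comm]
  -- regroup the 72 pairings into six shape groups (opaque local definitions keep the distribution small)
  set g₁ : (E × Fin 3) → (E × Fin 3) → (E × Fin 3) → (E × Fin 3) → ℝ := fun a a' b b' =>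
      LA a a' * LB b b' * ((S a n₀ * S a' n₁) * (S b n₂ * S b' n₃)) +
      LA a a' * LB b b' * ((S a n₀ * S a' n₁) * (S b n₃ * S b' n₂)) +
      LA a a' * LB b b' * ((S a n₀ * S a' n₂) * (S b n₁ * S b' n₃)) +
      LA a a' * LB b b' * ((S a n₀ * S a' n₂) * (S b n₃ * S b' n₁)) +
      LA a a' * LB b b' * ((S a n₀ * S a' n₃) * (S b n₁ * S b' n₂)) +
      LA a a' * LB b b' * ((S a n₀ * S a' n₃) * (S b n₂ * S b' n₁)) +
      LA a a' * LB b b' * ((S a n₁ * S a' n₀) * (S b n₂ * S b' n₃)) +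
      LA a a' * LB b b' * ((S a n₁ * S a' n₀) * (S b n₃ * S b' n₂)) +
      LA a a' * LB b b' * ((S a n₁ * S a' n₂) * (S b n₀ * S b' n₃)) +
      LA a a' * LB b b' * ((S a n₁ * S a' n₂) * (S b n₃ * S b' n₀)) +
      LA a a' * LB b b' * ((S a n₁ * S a' n₃) * (S b n₀ * S b' n₂)) +
      LA a a' * LB b b' * ((S a n₁ * S a' n₃) * (S b n₂ * S b' n₀)) with hg₁
  set g₂ : (E × Fin 3) → (E × Fin 3) → (E × Fin 3) → (E × Fin 3) → ℝ := fun a a' b b' =>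
      LA a a' * LB b b' * ((S a n₂ * S a' n₀) * (S b n₁ * S b' n₃)) +
      LA a a' * LB b b' * ((S a n₂ * S a' n₀) * (S b n₃ * S b' n₁)) +
      LA a a' * LB b b' * ((S a n₂ * S a' n₁) * (S b n₀ * S b' n₃)) +
      LA a a' * LB b b' * ((S a n₂ * S a' n₁) * (S b n₃ * S b' n₀)) +
      LA a a' * LB b b' * ((S a n₂ * S a' n₃) * (S b n₀ * S b' n₁)) +
      LA a a' * LB b b' * ((S a n₂ * S a' n₃) * (S b n₁ * S b' n₀)) +
      LA a a' * LB b b' * ((S a n₃ * S a' n₀) * (S b n₁ * S b' n₂)) +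
      LA a a' * LB b b' * ((S a n₃ * S a' n₀) * (S b n₂ * S b' n₁)) +
      LA a a' * LB b b' * ((S a n₃ * S a' n₁) * (S b n₀ * S b' n₂)) +
      LA a a' * LB b b' * ((S a n₃ * S a' n₁) * (S b n₂ * S b' n₀)) +
      LA a a' * LB b b' * ((S a n₃ * S a' n₂) * (S b n₀ * S b' n₁)) +
      LA a a' * LB b b' * ((S a n₃ * S a' n₂) * (S b n₁ * S b' n₀)) with hg₂
  set g₃ : (E × Fin 3) → (E × Fin 3) → (E × Fin 3) → (E × Fin 3) → ℝ := fun a a' b b' =>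
      LA a a' * LB b b' * (((S a b * S a' n₀) * S b' n₁) * S n₂ n₃) +
      LA a a' * LB b b' * (((S a b * S a' n₀) * S b' n₂) * S n₁ n₃) +
      LA a a' * LB b b' * (((S a b * S a' n₀) * S b' n₃) * S n₁ n₂) +
      LA a a' * LB b b' * (((S a b * S a' n₁) * S b' n₀) * S n₂ n₃) +
      LA a a' * LB b b' * (((S a b * S a' n₁) * S b' n₂) * S n₀ n₃) +
      LA a a' * LB b b' * (((S a b * S a' n₁) * S b' n₃) * S n₀ n₂) +
      LA a a' * LB b b' * (((S a b * S a' n₂) * S b' n₀) * S n₁ n₃) +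
      LA a a' * LB b b' * (((S a b * S a' n₂) * S b' n₁) * S n₀ n₃) +
      LA a a' * LB b b' * (((S a b * S a' n₂) * S b' n₃) * S n₀ n₁) +
      LA a a' * LB b b' * (((S a b * S a' n₃) * S b' n₀) * S n₁ n₂) +
      LA a a' * LB b b' * (((S a b * S a' n₃) * S b' n₁) * S n₀ n₂) +
      LA a a' * LB b b' * (((S a b * S a' n₃) * S b' n₂) * S n₀ n₁) with hg₃
  set g₄ : (E × Fin 3) → (E × Fin 3) → (E × Fin 3) → (E × Fin 3) → ℝ := fun a a' b b' =>
      LA a a' * LB b b' * (((S a b' * S a' n₀) * S b n₁) * S n₂ n₃) +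
      LA a a' * LB b b' * (((S a b' * S a' n₀) * S b n₂) * S n₁ n₃) +
      LA a a' * LB b b' * (((S a b' * S a' n₀) * S b n₃) * S n₁ n₂) +
      LA a a' * LB b b' * (((S a b' * S a' n₁) * S b n₀) * S n₂ n₃) +
      LA a a' * LB b b' * (((S a b' * S a' n₁) * S b n₂) * S n₀ n₃) +
      LA a a' * LB b b' * (((S a b' * S a' n₁) * S b n₃) * S n₀ n₂) +
      LA a a' * LB b b' * (((S a b' * S a' n₂) * S b n₀) * S n₁ n₃) +
      LA a a' * LB b b' * (((S a b' * S a' n₂) * S b n₁) * S n₀ n₃) +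
      LA a a' * LB b b' * (((S a b' * S a' n₂) * S b n₃) * S n₀ n₁) +
      LA a a' * LB b b' * (((S a b' * S a' n₃) * S b n₀) * S n₁ n₂) +
      LA a a' * LB b b' * (((S a b' * S a' n₃) * S b n₁) * S n₀ n₂) +
      LA a a' * LB b b' * (((S a b' * S a' n₃) * S b n₂) * S n₀ n₁) with hg₄
  set g₅ : (E × Fin 3) → (E × Fin 3) → (E × Fin 3) → (E × Fin 3) → ℝ := fun a a' b b' =>
      LA a a' * LB b b' * (((S a n₀ * S a' b) * S b' n₁) * S n₂ n₃) +
      LA a a' * LB b b' * (((S a n₀ * S a' b) * S b' n₂) * S n₁ n₃) +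
      LA a a' * LB b b' * (((S a n₀ * S a' b) * S b' n₃) * S n₁ n₂) +
      LA a a' * LB b b' * (((S a n₁ * S a' b) * S b' n₀) * S n₂ n₃) +
      LA a a' * LB b b' * (((S a n₁ * S a' b) * S b' n₂) * S n₀ n₃) +
      LA a a' * LB b b' * (((S a n₁ * S a' b) * S b' n₃) * S n₀ n₂) +
      LA a a' * LB b b' * (((S a n₂ * S a' b) * S b' n₀) * S n₁ n₃) +
      LA a a' * LB b b' * (((S a n₂ * S a' b) * S b' n₁) * S n₀ n₃) +
      LA a a' * LB b b' * (((S a n₂ * S a' b) * S b' n₃) * S n₀ n₁) +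
      LA a a' * LB b b' * (((S a n₃ * S a' b) * S b' n₀) * S n₁ n₂) +
      LA a a' * LB b b' * (((S a n₃ * S a' b) * S b' n₁) * S n₀ n₂) +
      LA a a' * LB b b' * (((S a n₃ * S a' b) * S b' n₂) * S n₀ n₁) with hg₅
  set g₆ : (E × Fin 3) → (E × Fin 3) → (E × Fin 3) → (E × Fin 3) → ℝ := fun a a' b b' =>
      LA a a' * LB b b' * (((S a n₀ * S a' b') * S b n₁) * S n₂ n₃) +
      LA a a' * LB b b' * (((S a n₀ * S a' b') * S b n₂) * S n₁ n₃) +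
      LA a a' * LB b b' * (((S a n₀ * S a' b') * S b n₃) * S n₁ n₂) +
      LA a a' * LB b b' * (((S a n₁ * S a' b') * S b n₀) * S n₂ n₃) +
      LA a a' * LB b b' * (((S a n₁ * S a' b') * S b n₂) * S n₀ n₃) +
      LA a a' * LB b b' * (((S a n₁ * S a' b') * S b n₃) * S n₀ n₂) +
      LA a a' * LB b b' * (((S a n₂ * S a' b') * S b n₀) * S n₁ n₃) +
      LA a a' * LB b b' * (((S a n₂ * S a' b') * S b n₁) * S n₀ n₃) +
      LA a a' * LB b b' * (((S a n₂ * S a' b') * S b n₃) * S n₀ n₁) +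
      LA a a' * LB b b' * (((S a n₃ * S a' b') * S b n₀) * S n₁ n₂) +
      LA a a' * LB b b' * (((S a n₃ * S a' b') * S b n₁) * S n₀ n₂) +
      LA a a' * LB b b' * (((S a n₃ * S a' b') * S b n₂) * S n₀ n₁) with hg₆
  have hsplit : ∀ a a' b b' : E × Fin 3, LA a a' * LB b b' *
        (S a b * S a' n₀ * S b' n₁ * S n₂ n₃ +
        S a b * S a' n₀ * S b' n₂ * S n₁ n₃ +
        S a b * S a' n₀ * S b' n₃ * S n₁ n₂ +
        S a b * S a' n₁ * S b' n₀ * S n₂ n₃ +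
        S a b * S a' n₁ * S b' n₂ * S n₀ n₃ +
        S a b * S a' n₁ * S b' n₃ * S n₀ n₂ +
        S a b * S a' n₂ * S b' n₀ * S n₁ n₃ +
        S a b * S a' n₂ * S b' n₁ * S n₀ n₃ +
        S a b * S a' n₂ * S b' n₃ * S n₀ n₁ +
        S a b * S a' n₃ * S b' n₀ * S n₁ n₂ +
        S a b * S a' n₃ * S b' n₁ * S n₀ n₂ +
        S a b * S a' n₃ * S b' n₂ * S n₀ n₁ +
        S a b' * S a' n₀ * S b n₁ * S n₂ n₃ +
        S a b' * S a' n₀ * S b n₂ * S n₁ n₃ +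
        S a b' * S a' n₀ * S b n₃ * S n₁ n₂ +
        S a b' * S a' n₁ * S b n₀ * S n₂ n₃ +
        S a b' * S a' n₁ * S b n₂ * S n₀ n₃ +
        S a b' * S a' n₁ * S b n₃ * S n₀ n₂ +
        S a b' * S a' n₂ * S b n₀ * S n₁ n₃ +
        S a b' * S a' n₂ * S b n₁ * S n₀ n₃ +
        S a b' * S a' n₂ * S b n₃ * S n₀ n₁ +
        S a b' * S a' n₃ * S b n₀ * S n₁ n₂ +
        S a b' * S a' n₃ * S b n₁ * S n₀ n₂ +
        S a b' * S a' n₃ * S b n₂ * S n₀ n₁ +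
        S a n₀ * S a' b * S b' n₁ * S n₂ n₃ +
        S a n₀ * S a' b * S b' n₂ * S n₁ n₃ +
        S a n₀ * S a' b * S b' n₃ * S n₁ n₂ +
        S a n₀ * S a' b' * S b n₁ * S n₂ n₃ +
        S a n₀ * S a' b' * S b n₂ * S n₁ n₃ +
        S a n₀ * S a' b' * S b n₃ * S n₁ n₂ +
        S a n₀ * S a' n₁ * S b n₂ * S b' n₃ +
        S a n₀ * S a' n₁ * S b n₃ * S b' n₂ +
        S a n₀ * S a' n₂ * S b n₁ * S b' n₃ +
        S a n₀ * S a' n₂ * S b n₃ * S b' n₁ +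
        S a n₀ * S a' n₃ * S b n₁ * S b' n₂ +
        S a n₀ * S a' n₃ * S b n₂ * S b' n₁ +
        S a n₁ * S a' b * S b' n₀ * S n₂ n₃ +
        S a n₁ * S a' b * S b' n₂ * S n₀ n₃ +
        S a n₁ * S a' b * S b' n₃ * S n₀ n₂ +
        S a n₁ * S a' b' * S b n₀ * S n₂ n₃ +
        S a n₁ * S a' b' * S b n₂ * S n₀ n₃ +
        S a n₁ * S a' b' * S b n₃ * S n₀ n₂ +
        S a n₁ * S a' n₀ * S b n₂ * S b' n₃ +
        S a n₁ * S a' n₀ * S b n₃ * S b' n₂ +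
        S a n₁ * S a' n₂ * S b n₀ * S b' n₃ +
        S a n₁ * S a' n₂ * S b n₃ * S b' n₀ +
        S a n₁ * S a' n₃ * S b n₀ * S b' n₂ +
        S a n₁ * S a' n₃ * S b n₂ * S b' n₀ +
        S a n₂ * S a' b * S b' n₀ * S n₁ n₃ +
        S a n₂ * S a' b * S b' n₁ * S n₀ n₃ +
        S a n₂ * S a' b * S b' n₃ * S n₀ n₁ +
        S a n₂ * S a' b' * S b n₀ * S n₁ n₃ +
        S a n₂ * S a' b' * S b n₁ * S n₀ n₃ +
        S a n₂ * S a' b' * S b n₃ * S n₀ n₁ +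
        S a n₂ * S a' n₀ * S b n₁ * S b' n₃ +
        S a n₂ * S a' n₀ * S b n₃ * S b' n₁ +
        S a n₂ * S a' n₁ * S b n₀ * S b' n₃ +
        S a n₂ * S a' n₁ * S b n₃ * S b' n₀ +
        S a n₂ * S a' n₃ * S b n₀ * S b' n₁ +
        S a n₂ * S a' n₃ * S b n₁ * S b' n₀ +
        S a n₃ * S a' b * S b' n₀ * S n₁ n₂ +
        S a n₃ * S a' b * S b' n₁ * S n₀ n₂ +
        S a n₃ * S a' b * S b' n₂ * S n₀ n₁ +
        S a n₃ * S a' b' * S b n₀ * S n₁ n₂ +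
        S a n₃ * S a' b' * S b n₁ * S n₀ n₂ +
        S a n₃ * S a' b' * S b n₂ * S n₀ n₁ +
        S a n₃ * S a' n₀ * S b n₁ * S b' n₂ +
        S a n₃ * S a' n₀ * S b n₂ * S b' n₁ +
        S a n₃ * S a' n₁ * S b n₀ * S b' n₂ +
        S a n₃ * S a' n₁ * S b n₂ * S b' n₀ +
        S a n₃ * S a' n₂ * S b n₀ * S b' n₁ +
        S a n₃ * S a' n₂ * S b n₁ * S b' n₀) =
      g₁ a a' b b' + g₂ a a' b b' + g₃ a a' b b' + g₄ a a' b b' + g₅ a a' b b' + g₆ a a' b b' := fun a a' b b' => by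
    simp only [hg₁, hg₂, hg₃, hg₄, hg₅, hg₆]; ring
  rw [QuadCum3.sum4_congr hsplit]
  simp only [Finset.sum_add_distrib]
  rw [show (∑ a, ∑ a', ∑ b, ∑ b', g₁ a a' b b') = _ from by
        simp only [hg₁]; exact sumLL_X1 LA LB S DA DB hXc n₀ n₁ n₂ n₃]
  rw [show (∑ a, ∑ a', ∑ b, ∑ b', g₂ a a' b b') = _ from by
        simp only [hg₂]; exact sumLL_X2 LA LB S DA DB hXc n₀ n₁ n₂ n₃]
  rw [show (∑ a, ∑ a', ∑ b, ∑ b', g₃ a a' b b') = _ from by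
        simp only [hg₃]; exact sumLL_T1 LA LB S TD hT1 n₀ n₁ n₂ n₃]
  rw [show (∑ a, ∑ a', ∑ b, ∑ b', g₄ a a' b b') = _ from by
        simp only [hg₄]; exact sumLL_T2 LA LB S TD hT2 n₀ n₁ n₂ n₃]
  rw [show (∑ a, ∑ a', ∑ b, ∑ b', g₅ a a' b b') = _ from by
        simp only [hg₅]; exact sumLL_T3 LA LB S TD hT3 n₀ n₁ n₂ n₃]
  rw [show (∑ a, ∑ a', ∑ b, ∑ b', g₆ a a' b b') = _ from by
        simp only [hg₆]; exact sumLL_T4 LA LB S TD hT4 n₀ n₁ n₂ n₃]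
  simp only [hDAs n₁ n₀, hDAs n₂ n₀, hDAs n₃ n₀, hDAs n₂ n₁, hDAs n₃ n₁, hDAs n₃ n₂,
    hDBs n₁ n₀, hDBs n₂ n₀, hDBs n₃ n₀, hDBs n₂ n₁, hDBs n₃ n₁, hDBs n₃ n₂]
  ring

end RankOneQuartic

end Summit.QuantumFields.YangMills.Theorems.AllWindowsColdBoxBoxHighLine

end
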